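import Literature.Analysis.FluidPDE.PassiveScalarEnergyPointwise
import Literature.Analysis.FluidPDE.PassiveScalarUniquenessL1Sobolev
import Literature.Analysis.FluidPDE.PassiveScalarForcedClass
import Literature.Analysis.FluidPDE.ParabolicScalarSolutions
import HarnessLib

/-!
# Uniqueness and `L²` contraction of weak passive scalars for BOUNDED drifts
  (Bonicatto–Ciampa–Crippa 2024, Cor. 3.5 in the corner `p = ∞`, `q = 2`, for every `κ > 0`;
  the sourced equation; all proved)

Analysis/FluidPDE proof-support file, Literature-side home of three facts that several
Literature docstrings use («for a bounded drift and `κ > 0` the weak solutions in `L^∞_t L²_x` are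
unique energy solutions»: `AcceleratingDissipationEnhancement`, `UniversalTotalAnomalousDissipator`,
`PassiveScalar` — docstring of `Torus.IsWeakScalarTransportOn.energy_ineq`) and that so far were
proved only on the Summits side (`Summits/AnomalousDissipation/…/Theorems/
LimitingAbsorptionKinematicSteadySourceLawToolkit.lean`, `…/TwoAndHalfDSourcedScalarUnique2DDifference.lean`,
which Literature files cannot import):

* `Torus.IsWeakScalarTransportForcedOn.sub_of_eq` — the difference of two weak solutions of the
  SOURCED equation `∂ₜθ + u·∇θ = κΔθ + s` with the same datum and source is a weak solution of the
  homogeneous equation with datum `0` (linearity of the distributional formulation,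
  DiPerna–Lions 1989, §II.1), with its class bookkeeping `lintegral_mul_sub_lt_top`,
  `ae_lintegral_sq_sub_le`;
* `Torus.IsWeakScalarTransportOn.ae_eq_of_memLp_top` — **uniqueness for bounded drift**: for
  `κ > 0` and `u ∈ L^∞((0,T) × T^d)`, two weak solutions in `L^∞_t L²_x` with the same datum agree
  for a.e. `t` — Bonicatto–Ciampa–Crippa 2024, Cor. 3.5 («there exists at most one distributional
  solution `u ∈ L^∞([0,T];L^q)`» for `b ∈ L²_t L^p_x`, `1/p + 1/q ≤ 1/2`) in the corner `p = ∞`,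
  `q = 2`, here for EVERY `κ > 0` and with no integrability of the datum (the difference has datum
  `0`; the tree's pointwise energy inequality `IsWeakScalarTransportOn.lintegral_sq_add_le_holds`
  — the source's Thm. 3.3 at `p = ∞`, `q = 2` — kills it); the sourced twin
  `Torus.IsWeakScalarTransportForcedOn.ae_eq_of_memLp_top`; the parabolic-class reading
  `Torus.IsParabolicScalarSolutionOn.ae_eq_of_memLp_top`;
* `Torus.IsWeakScalarTransportOn.ae_lintegral_sq_le_of_memLp_top` / `ae_scalarL2Sq_le_of_memLp_top`
  — **`L²` contraction**: `‖θ(t)‖²_{L²} ≤ ‖θ₀‖²_{L²}` for a.e. `t ∈ (0,T)` (DEIJ 2022, (1.3)).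

No derivative of the drift is used anywhere (contrast `unique_of_lipschitz_holds`,
`unique_of_lintegral_eGradNormSq_rpow_lt_top`); boundedness of the drift is what makes every
`L^∞_t L²_x` solution parabolic (`IsWeakScalarTransportOn.isParabolicScalarSolutionOn_of_bounded`).
For `L²_t L²_x` drifts uniqueness holds in the parabolic class only (the source's Thm. 2.7, tree
fact `BonicattoCiampaCrippa2024_thm27`, not used here).

## Mathlib / tree search

Tree: `IsWeakScalarTransportOn.sub_of_eq_datum` (PassiveScalarUniquenessL1Sobolev),
`IsWeakScalarTransportOn.lintegral_sq_add_le_holds` (PassiveScalarEnergyPointwise), forced-class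
API `PassiveScalarForcedClass`; Summits-side duplicates named above (provers may rewire them to
this file). `lean search 'ae_eq_of_memLp_top' --decl`: no Literature declaration.

## References

* P. Bonicatto, G. Ciampa, G. Crippa, *Weak and parabolic solutions of advection–diffusion
  equations with rough velocity field*, J. Evol. Equ. 24 (2024) 1 = arXiv:2306.15529, Thm. 3.3,
  Cor. 3.5. [`BonicattoCiampaCrippa2023`]
* R. J. DiPerna, P.-L. Lions, Invent. Math. 98 (1989), §II.1. [`DiPernaLions1989`]
* T. D. Drivas, T. M. Elgindi, G. Iyer, I.-J. Jeong, ARMA 243 (2022), (1.3). [`DEIJ2022`]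
-/

noncomputable section

open MeasureTheory Set Filter Function TopologicalSpace
open scoped ENNReal NNReal InnerProductSpace

namespace Literature.Analysis.FluidPDE

namespace Torus

variable {d : Type*} [Fintype d]

/-! ## The difference of two sourced weak solutions -/

namespace IsWeakScalarTransportForcedOn

variable {T κ : ℝ} {u : ℝ → UnitAddTorus d → EuclideanSpace ℝ d} {s : ℝ → UnitAddTorus d → ℝ}
  {θ₀ : UnitAddTorus d → ℝ} {θ₁ θ₂ : ℝ → UnitAddTorus d → ℝ}

/-- `‖u‖ (θ₁ - θ₂) ∈ L¹((0,T) × T^d)` in the iterated-`lintegral` form of the solution class.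
[cite: DiPernaLions1989, §II.1] -/
theorem lintegral_mul_sub_lt_top (h₁ : IsWeakScalarTransportForcedOn T κ u s θ₀ θ₁)
    (h₂ : IsWeakScalarTransportForcedOn T κ u s θ₀ θ₂) :
    ∫⁻ t in Ioo 0 T, ∫⁻ x, ‖u t x‖ₑ * ‖θ₁ t x - θ₂ t x‖ₑ < ⊤ := by
  set μT : Measure ℝ := (volume : Measure ℝ).restrict (Ioo 0 T) with hμT
  have hmu := h₁.aestronglyMeasurable_uncurry_velocity
  have hm₁ := h₁.aestronglyMeasurable_uncurry
  have hm₂ := h₂.aestronglyMeasurable_uncurry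
  have hF : AEMeasurable (fun p : ℝ × UnitAddTorus d => ‖u p.1 p.2‖ₑ * ‖θ₁ p.1 p.2 - θ₂ p.1 p.2‖ₑ)
      (μT.prod volume) := hmu.enorm.mul (hm₁.sub hm₂).enorm
  have hF₁ : AEMeasurable (fun p : ℝ × UnitAddTorus d => ‖u p.1 p.2‖ₑ * ‖θ₁ p.1 p.2‖ₑ) (μT.prod volume) :=
    hmu.enorm.mul hm₁.enorm
  have hF₂ : AEMeasurable (fun p : ℝ × UnitAddTorus d => ‖u p.1 p.2‖ₑ * ‖θ₂ p.1 p.2‖ₑ) (μT.prod volume) :=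
    hmu.enorm.mul hm₂.enorm
  have e : ∫⁻ t in Ioo 0 T, ∫⁻ x, ‖u t x‖ₑ * ‖θ₁ t x - θ₂ t x‖ₑ =
      ∫⁻ p, ‖u p.1 p.2‖ₑ * ‖θ₁ p.1 p.2 - θ₂ p.1 p.2‖ₑ ∂(μT.prod volume) := (lintegral_prod _ hF).symm
  rw [e]
  calc ∫⁻ p, ‖u p.1 p.2‖ₑ * ‖θ₁ p.1 p.2 - θ₂ p.1 p.2‖ₑ ∂(μT.prod volume)
      ≤ ∫⁻ p, (‖u p.1 p.2‖ₑ * ‖θ₁ p.1 p.2‖ₑ + ‖u p.1 p.2‖ₑ * ‖θ₂ p.1 p.2‖ₑ) ∂(μT.prod volume) := by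
        refine lintegral_mono fun p => ?_
        rw [← mul_add]
        gcongr
        exact enorm_sub_le
    _ = (∫⁻ p, ‖u p.1 p.2‖ₑ * ‖θ₁ p.1 p.2‖ₑ ∂(μT.prod volume)) +
          ∫⁻ p, ‖u p.1 p.2‖ₑ * ‖θ₂ p.1 p.2‖ₑ ∂(μT.prod volume) := lintegral_add_left' hF₁ _
    _ = (∫⁻ t in Ioo 0 T, ∫⁻ x, ‖u t x‖ₑ * ‖θ₁ t x‖ₑ) + ∫⁻ t in Ioo 0 T, ∫⁻ x, ‖u t x‖ₑ * ‖θ₂ t x‖ₑ := by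
        rw [lintegral_prod _ hF₁, lintegral_prod _ hF₂]
    _ < ⊤ := ENNReal.add_lt_top.2 ⟨h₁.lintegral_mul_lt_top, h₂.lintegral_mul_lt_top⟩

/-- `θ₁ - θ₂ ∈ L^∞(0,T; L²)`: `∫ |θ₁(t) - θ₂(t)|² ≤ (C₁ + C₂)²` for a.e. `t`.
[cite: DiPernaLions1989, §II.1] -/
theorem ae_lintegral_sq_sub_le (h₁ : IsWeakScalarTransportForcedOn T κ u s θ₀ θ₁)
    (h₂ : IsWeakScalarTransportForcedOn T κ u s θ₀ θ₂) :
    ∃ C : ℝ≥0, ∀ᵐ t ∂(volume.restrict (Ioo 0 T)), ∫⁻ x, ‖θ₁ t x - θ₂ t x‖ₑ ^ 2 ≤ C := by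
  obtain ⟨C₁, hC₁⟩ := h₁.exists_eLpNorm_le
  obtain ⟨C₂, hC₂⟩ := h₂.exists_eLpNorm_le
  refine ⟨(C₁ + C₂) ^ 2, ?_⟩
  filter_upwards [hC₁, hC₂, h₁.ae_memLp_two, h₂.ae_memLp_two] with t hc₁ hc₂ hm₁ hm₂
  have hsub : eLpNorm (θ₁ t - θ₂ t) 2 volume ≤ C₁ + C₂ :=
    (eLpNorm_sub_le hm₁.1 hm₂.1 one_le_two).trans (add_le_add hc₁ hc₂)
  have e : ∫⁻ x, ‖θ₁ t x - θ₂ t x‖ₑ ^ 2 = eLpNorm (θ₁ t - θ₂ t) 2 volume ^ 2 := by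
    rw [PassiveScalarProofs.eLpNorm_two_pow_two]
    rfl
  rw [e, ENNReal.coe_pow, ENNReal.coe_add]
  exact pow_le_pow_left' hsub 2

/-- **Linearity of the sourced weak class**: the difference of two weak solutions of
`∂ₜθ + u·∇θ = κΔθ + s` on `T^d × [0,T)` with the same drift, source and datum is a weak solution of
the homogeneous equation `∂ₜθ + u·∇θ = κΔθ` with datum `0` (the source and datum terms of
`∫∫ θ(∂ₜψ + u·∇ψ + κΔψ) + ∫∫ sψ + ∫ θ₀ψ(0) = 0` cancel; the class conditions `L^∞_t L²_x`,
`uθ ∈ L¹` pass to differences). [cite: DiPernaLions1989, §II.1] -/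
theorem sub_of_eq (h₁ : IsWeakScalarTransportForcedOn T κ u s θ₀ θ₁)
    (h₂ : IsWeakScalarTransportForcedOn T κ u s θ₀ θ₂) :
    IsWeakScalarTransportOn T κ u 0 (fun t x => θ₁ t x - θ₂ t x) where
  aestronglyMeasurable := h₁.aestronglyMeasurable.sub h₂.aestronglyMeasurable
  aestronglyMeasurable_velocity := h₁.aestronglyMeasurable_velocity
  ae_lintegral_sq_le := ae_lintegral_sq_sub_le h₁ h₂
  lintegral_velocity_lt_top := h₁.lintegral_velocity_lt_top
  lintegral_mul_lt_top := lintegral_mul_sub_lt_top h₁ h₂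
  ae_isWeaklyDivFree := h₁.ae_isWeaklyDivFree
  weak_eq ψ hψ := by
    have e₁ := h₁.weak_eq ψ hψ
    have e₂ := h₂.weak_eq ψ hψ
    have hI₁ := h₁.integrable_weakIntegrand hψ
    have hI₂ := h₂.integrable_weakIntegrand hψ
    have hslice : ∀ᵐ t ∂(volume.restrict (Ioo 0 T)),
        ∫ x, (θ₁ t x - θ₂ t x) * (FunctionSpaces.Torus.timeDeriv ψ t x +
          ⟪u t x, FunctionSpaces.Torus.gradient (ψ t) x⟫_ℝ + κ * FunctionSpaces.Torus.laplacian (ψ t) x) =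
        (∫ x, θ₁ t x * (FunctionSpaces.Torus.timeDeriv ψ t x +
          ⟪u t x, FunctionSpaces.Torus.gradient (ψ t) x⟫_ℝ + κ * FunctionSpaces.Torus.laplacian (ψ t) x)) -
        ∫ x, θ₂ t x * (FunctionSpaces.Torus.timeDeriv ψ t x +
          ⟪u t x, FunctionSpaces.Torus.gradient (ψ t) x⟫_ℝ + κ * FunctionSpaces.Torus.laplacian (ψ t) x) := by
      filter_upwards [hI₁.prod_right_ae, hI₂.prod_right_ae] with t ht₁ ht₂
      rw [← integral_sub ht₁ ht₂]
      refine integral_congr_ae (Eventually.of_forall fun x => ?_)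
      dsimp only
      ring
    rw [integral_congr_ae hslice, integral_sub hI₁.integral_prod_left hI₂.integral_prod_left]
    simp only [Pi.zero_apply, zero_mul, integral_zero, add_zero]
    linarith

end IsWeakScalarTransportForcedOn

/-! ## Uniqueness and `L²` contraction for bounded drifts -/

namespace IsWeakScalarTransportOn

variable {T κ : ℝ} {u : ℝ → UnitAddTorus d → EuclideanSpace ℝ d} {θ₀ : UnitAddTorus d → ℝ}
  {θ θ₁ θ₂ : ℝ → UnitAddTorus d → ℝ}

/-- **Uniqueness for bounded drift** (Bonicatto–Ciampa–Crippa 2024, Cor. 3.5 — «if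
`b ∈ L²([0,T];L^p(T^d))` is a divergence-free vector field, then there exists at most one
distributional solution `u ∈ L^∞([0,T];L^q(T^d))`», `1/p + 1/q ≤ 1/2` — in the corner `p = ∞`,
`q = 2`, for every `κ > 0`): for a velocity field `u ∈ L^∞((0,T) × T^d)` (space–time lift), two
weak solutions of `∂ₜθ + u·∇θ = κΔθ` in `L^∞_t L²_x` with the same datum agree for a.e.
`t ∈ (0,T)`. The difference solves the homogeneous problem from datum `0` (`sub_of_eq_datum`) and
the pointwise energy inequality for bounded drift (`lintegral_sq_add_le_holds`, the source's
Thm. 3.3 at `p = ∞`, `q = 2`) gives `∫ |θ₁(t) - θ₂(t)|² ≤ 0`; no integrability of `θ₀` and no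
derivative of `u` are needed. [cite: BonicattoCiampaCrippa2023, Cor. 3.5 (case p = ∞, q = 2)] -/
theorem ae_eq_of_memLp_top (hκ : 0 < κ)
    (h₁ : IsWeakScalarTransportOn T κ u θ₀ θ₁) (h₂ : IsWeakScalarTransportOn T κ u θ₀ θ₂)
    (hu : MemLp (FunctionSpaces.Torus.stLift u) ∞ (volume.restrict (Ioo 0 T ×ˢ univ))) :
    ∀ᵐ t ∂(volume.restrict (Ioo 0 T)), θ₁ t =ᵐ[volume] θ₂ t := by
  have hd := h₁.sub_of_eq_datum h₂
  have hE := IsWeakScalarTransportOn.lintegral_sq_add_le_holds hκ hd MemLp.zero hu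
  filter_upwards [hE, hd.ae_aestronglyMeasurable_slice] with t ht hm
  have hrhs : ∫⁻ x, ‖(0 : UnitAddTorus d → ℝ) x‖ₑ ^ 2 = 0 := by simp
  have h0 : ∫⁻ x, ‖θ₁ t x - θ₂ t x‖ₑ ^ 2 = 0 :=
    le_antisymm ((le_self_add.trans ht).trans hrhs.le) zero_le
  have hae : ∀ᵐ x ∂volume, ‖θ₁ t x - θ₂ t x‖ₑ ^ 2 = 0 :=
    (lintegral_eq_zero_iff' (hm.enorm.pow_const 2)).1 h0
  filter_upwards [hae] with x hx
  have hx' : ‖θ₁ t x - θ₂ t x‖ₑ = 0 := by simpa using hx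
  rwa [enorm_eq_zero, sub_eq_zero] at hx'

/-- **`L²` contraction for bounded drift**, `lintegral` form: for `κ > 0`, `u ∈ L^∞((0,T) × T^d)`
and `θ₀ ∈ L²`, every weak solution obeys `∫ |θ(t)|² ≤ ∫ |θ₀|²` for a.e. `t ∈ (0,T)` (drop the
dissipation in `lintegral_sq_add_le_holds`). [cite: DEIJ2022, (1.3)] -/
theorem ae_lintegral_sq_le_of_memLp_top (hκ : 0 < κ) (h : IsWeakScalarTransportOn T κ u θ₀ θ)
    (hθ₀ : MemLp θ₀ 2 volume)
    (hu : MemLp (FunctionSpaces.Torus.stLift u) ∞ (volume.restrict (Ioo 0 T ×ˢ univ))) :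
    ∀ᵐ t ∂(volume.restrict (Ioo 0 T)), ∫⁻ x, ‖θ t x‖ₑ ^ 2 ≤ ∫⁻ x, ‖θ₀ x‖ₑ ^ 2 := by
  filter_upwards [IsWeakScalarTransportOn.lintegral_sq_add_le_holds hκ h hθ₀ hu] with t ht
  exact le_self_add.trans ht

/-- `‖f‖²_{L²}` in the `scalarL2Sq` currency is the real part of the finite `lintegral`
`∫⁻ ‖f‖ₑ²` for `f ∈ L²(T^d)`. [folklore] -/
private theorem scalarL2Sq_eq_toReal_lintegral_and_lt_top {f : UnitAddTorus d → ℝ}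
    (hf : MemLp f 2 volume) :
    scalarL2Sq f = (∫⁻ x, ‖f x‖ₑ ^ 2).toReal ∧ ∫⁻ x, ‖f x‖ₑ ^ 2 < ⊤ := by
  constructor
  · change ∫ x, f x ^ 2 = _
    rw [integral_eq_lintegral_of_nonneg_ae (Eventually.of_forall fun x => sq_nonneg (f x))
      (hf.integrable_sq.aestronglyMeasurable)]
    congr 1
    refine lintegral_congr fun x => ?_
    rw [Real.enorm_eq_ofReal_abs, ← ENNReal.ofReal_pow (abs_nonneg _), sq_abs]
  · rw [← PassiveScalarProofs.eLpNorm_two_pow_two]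
    exact ENNReal.pow_lt_top hf.eLpNorm_lt_top

/-- **`L²` contraction for bounded drift**, `scalarL2Sq` form: `‖θ(t)‖²_{L²} ≤ ‖θ₀‖²_{L²}` for
a.e. `t ∈ (0,T)`. [cite: DEIJ2022, (1.3)] -/
theorem ae_scalarL2Sq_le_of_memLp_top (hκ : 0 < κ) (h : IsWeakScalarTransportOn T κ u θ₀ θ)
    (hθ₀ : MemLp θ₀ 2 volume)
    (hu : MemLp (FunctionSpaces.Torus.stLift u) ∞ (volume.restrict (Ioo 0 T ×ˢ univ))) :
    ∀ᵐ t ∂(volume.restrict (Ioo 0 T)), scalarL2Sq (θ t) ≤ scalarL2Sq θ₀ := by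
  filter_upwards [h.ae_lintegral_sq_le_of_memLp_top hκ hθ₀ hu, h.ae_memLp_two] with t ht hm
  calc scalarL2Sq (θ t) = (∫⁻ x, ‖θ t x‖ₑ ^ 2).toReal :=
        (scalarL2Sq_eq_toReal_lintegral_and_lt_top hm).1
    _ ≤ (∫⁻ x, ‖θ₀ x‖ₑ ^ 2).toReal :=
        ENNReal.toReal_mono (scalarL2Sq_eq_toReal_lintegral_and_lt_top hθ₀).2.ne ht
    _ = scalarL2Sq θ₀ := (scalarL2Sq_eq_toReal_lintegral_and_lt_top hθ₀).1.symm

end IsWeakScalarTransportOn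

namespace IsWeakScalarTransportForcedOn

variable {T κ : ℝ} {u : ℝ → UnitAddTorus d → EuclideanSpace ℝ d} {s : ℝ → UnitAddTorus d → ℝ}
  {θ₀ : UnitAddTorus d → ℝ} {θ₁ θ₂ : ℝ → UnitAddTorus d → ℝ}

/-- **Uniqueness for bounded drift, sourced equation**: for `κ > 0` and `u ∈ L^∞((0,T) × T^d)`,
two weak solutions of `∂ₜθ + u·∇θ = κΔθ + s` in `L^∞_t L²_x` with the same datum and source
coincide for a.e. `t ∈ (0,T)` (their difference solves the homogeneous problem from datum `0`,
`sub_of_eq`; then `IsWeakScalarTransportOn.ae_eq_of_memLp_top`'s argument).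
[cite: BonicattoCiampaCrippa2023, Cor. 3.5 (case p = ∞, q = 2)] -/
theorem ae_eq_of_memLp_top (hκ : 0 < κ)
    (h₁ : IsWeakScalarTransportForcedOn T κ u s θ₀ θ₁) (h₂ : IsWeakScalarTransportForcedOn T κ u s θ₀ θ₂)
    (hu : MemLp (FunctionSpaces.Torus.stLift u) ∞ (volume.restrict (Ioo 0 T ×ˢ univ))) :
    ∀ᵐ t ∂(volume.restrict (Ioo 0 T)), θ₁ t =ᵐ[volume] θ₂ t := by
  have hd := h₁.sub_of_eq h₂
  have hE := IsWeakScalarTransportOn.lintegral_sq_add_le_holds hκ hd MemLp.zero hu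
  filter_upwards [hE, hd.ae_aestronglyMeasurable_slice] with t ht hm
  have hrhs : ∫⁻ x, ‖(0 : UnitAddTorus d → ℝ) x‖ₑ ^ 2 = 0 := by simp
  have h0 : ∫⁻ x, ‖θ₁ t x - θ₂ t x‖ₑ ^ 2 = 0 :=
    le_antisymm ((le_self_add.trans ht).trans hrhs.le) zero_le
  have hae : ∀ᵐ x ∂volume, ‖θ₁ t x - θ₂ t x‖ₑ ^ 2 = 0 :=
    (lintegral_eq_zero_iff' (hm.enorm.pow_const 2)).1 h0
  filter_upwards [hae] with x hx
  have hx' : ‖θ₁ t x - θ₂ t x‖ₑ = 0 := by simpa using hx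
  rwa [enorm_eq_zero, sub_eq_zero] at hx'

end IsWeakScalarTransportForcedOn

/-! ## The parabolic-class reading (Bonicatto–Ciampa–Crippa 2024, Cor. 3.5 at `p = ∞`, `q = 2`) -/

namespace IsParabolicScalarSolutionOn

variable {T κ : ℝ} {u : ℝ → UnitAddTorus d → EuclideanSpace ℝ d} {θ₀ : UnitAddTorus d → ℝ}
  {θ₁ θ₂ : ℝ → UnitAddTorus d → ℝ}

/-- **Uniqueness of parabolic solutions for bounded drift, every `κ > 0`**: two parabolic
solutions (Def. 2.3) with the same `L^∞` drift and datum agree for a.e. `t` — the parabolic class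
is contained in the weak class, where `IsWeakScalarTransportOn.ae_eq_of_memLp_top` applies; for
bounded drifts the two classes coincide (`IsWeakScalarTransportOn.isParabolicScalarSolutionOn_of_bounded`).
[cite: BonicattoCiampaCrippa2023, Cor. 3.5 (case p = ∞, q = 2)] -/
theorem ae_eq_of_memLp_top (hκ : 0 < κ)
    (h₁ : IsParabolicScalarSolutionOn T κ u θ₀ θ₁) (h₂ : IsParabolicScalarSolutionOn T κ u θ₀ θ₂)
    (hu : MemLp (FunctionSpaces.Torus.stLift u) ∞ (volume.restrict (Ioo 0 T ×ˢ univ))) :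
    ∀ᵐ t ∂(volume.restrict (Ioo 0 T)), θ₁ t =ᵐ[volume] θ₂ t :=
  h₁.isWeakScalarTransportOn.ae_eq_of_memLp_top hκ h₂.isWeakScalarTransportOn hu

end IsParabolicScalarSolutionOn

end Torus

end Literature.Analysis.FluidPDE

end
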